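import Summits.CriticalPhenomena.Ising3D.TaylorHMomentOne
import Summits.CriticalPhenomena.Ising3D.TaylorQPolyIntervalList
import Mathlib.Algebra.Group.ForwardDiff
import Mathlib.RingTheory.Binomial
import Mathlib.Tactic.Linarith
import Mathlib.Tactic.Positivity
import Mathlib.Tactic.Ring
import Mathlib.Tactic.FieldSimp
import HarnessLib

/-!
# The Legendre moments `hMoment k j` are POLYNOMIALS in `j` (elementary, via a λ-binomial convolution identity)
(cell `pub-ising3x`, seat recog-1 gen 11; gate (g2): the missing link for the EXACT `(E, j)`-polynomial region
route — with `qSum_eq_sum_hMoment_PD` every weighted q-sum becomes a polynomial in `(E, j)`, no kernel-route loss)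

HONEST FRAMING: lottery ticket; floor = tightest certified 3D Ising CFT bounds; no exact-solution
claim without a proof.

* **`sum_antidiagonal_lam_mul_choose`**: `Σ_{p₁+p₂=j} λ_{p₁} λ_{p₂} C(p₁, m) = λ_m C(j, m)` (coefficientwise
  `x^m (1-x)^{-m-1/2} · (1-x)^{-1/2} = x^m (1-x)^{-(m+1)}` up to the constant `λ_m`; proved here by induction on
  `m` with the λ-recurrence `(2i+2)λ_{i+1} = (2i+1)λ_i` and Pascal's rule — the technique of `hMoment_one`).
* Newton's forward-difference formula (Mathlib `shift_eq_sum_fwdDiff_iter`) applied to `p ↦ (2p - j)^{2k}` then gives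
  **`hMoment_eq_sum`**: `hMoment k j = Σ_{m ≤ 2k} λ_m C(j,m) Σ_{i ≤ m} (-1)^{m-i} C(m,i) (2i - j)^{2k}` — for fixed
  `k` a polynomial in `j` of degree `2k` (`h₀ = 1`, `h₁ = j(j+1)/2`, `h₂ = (3J²-2J)/8`, `J = j(j+1)`), with NO appeal
  to Legendre-polynomial theory.
* `hMomentListQ k : List ℚ` (computable coefficient list in `j`) with **`evalR_hMomentListQ`**:
  `evalR ((hMomentListQ k).map (↑)) (j : ℝ) = hMoment k j`.
Elementary. [folklore]
-/

namespace Summit.CriticalPhenomena.Ising3D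

open Finset
open Literature.Analysis.ValidatedNumerics Literature.Analysis.ValidatedNumerics.PolyMP
open Literature.MathematicalPhysics.QuantumFieldTheory.ConformalBootstrap3D

/-! ### The λ-binomial convolution identity -/

/-- `p·C(p,m) = (m+1)·C(p,m+1) + m·C(p,m)` in `ℕ`. [folklore] -/
theorem mul_choose_eq_succ (p m : ℕ) : p * p.choose m = (m + 1) * p.choose (m + 1) + m * p.choose m := by
  have h1 : (p + 1) * p.choose m = (p + 1).choose (m + 1) * (m + 1) := Nat.add_one_mul_choose_eq p m
  have h2 : (p + 1).choose (m + 1) = p.choose m + p.choose (m + 1) := Nat.choose_succ_succ' p m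
  rw [h2] at h1
  nlinarith [h1]

/-- **`Σ_{p₁+p₂=j} λ_{p₁} λ_{p₂} C(p₁,m) = λ_m · C(j,m)`.** [folklore] -/
theorem sum_antidiagonal_lam_mul_choose (m : ℕ) : ∀ j : ℕ,
    ∑ p ∈ antidiagonal j, legendreLam p.1 * legendreLam p.2 * (p.1.choose m : ℝ) =
      legendreLam m * (j.choose m : ℝ) := by
  induction m with
  | zero =>
      intro j
      simp only [Nat.choose_zero_right, Nat.cast_one, mul_one, legendreLam_zero]
      exact sum_antidiagonal_legendreLam_mul j
  | succ m ih =>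
      intro j
      induction j with
      | zero => simp
      | succ j ihj =>
          rw [Nat.sum_antidiagonal_succ]
          simp only [Nat.choose_zero_succ, Nat.cast_zero, mul_zero, zero_add]
          -- per term: (m+1) λ_{p+1} C(p+1,m+1) = λ_p ((m+1) C(p,m+1) + (m + ½) C(p,m))
          have hterm : ∀ p : ℕ × ℕ,
              ((m : ℝ) + 1) * (legendreLam (p.1 + 1) * legendreLam p.2 * (((p.1 + 1).choose (m + 1) : ℕ) : ℝ)) =
                ((m : ℝ) + 1) * (legendreLam p.1 * legendreLam p.2 * (p.1.choose (m + 1) : ℝ)) +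
                  ((m : ℝ) + 1 / 2) * (legendreLam p.1 * legendreLam p.2 * (p.1.choose m : ℝ)) := by
            intro p
            have hlam := legendreLam_succ_mul p.1
            have hc1 : ((p.1 : ℝ) + 1) * (p.1.choose m : ℝ) = (((p.1 + 1).choose (m + 1) : ℕ) : ℝ) * ((m : ℝ) + 1) := by
              exact_mod_cast Nat.add_one_mul_choose_eq p.1 m
            have hc2 : (p.1 : ℝ) * (p.1.choose m : ℝ) =
                ((m : ℝ) + 1) * (p.1.choose (m + 1) : ℝ) + (m : ℝ) * (p.1.choose m : ℝ) := by
              exact_mod_cast mul_choose_eq_succ p.1 m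
            -- (m+1) λ_{p+1} C(p+1,m+1) = λ_{p+1} (p+1) C(p,m) = ((2p+1)/2) λ_p C(p,m)
            have e1 : ((m : ℝ) + 1) * (legendreLam (p.1 + 1) * (((p.1 + 1).choose (m + 1) : ℕ) : ℝ)) =
                (2 * (p.1 : ℝ) + 1) / 2 * legendreLam p.1 * (p.1.choose m : ℝ) := by
              have : ((m : ℝ) + 1) * (legendreLam (p.1 + 1) * (((p.1 + 1).choose (m + 1) : ℕ) : ℝ)) =
                  legendreLam (p.1 + 1) * (((p.1 : ℝ) + 1) * (p.1.choose m : ℝ)) := by rw [hc1]; ring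
              rw [this]
              have h2 : (2 * (p.1 : ℝ) + 2) ≠ 0 := by positivity
              field_simp
              linear_combination ((p.1.choose m : ℝ)) * hlam
            calc ((m : ℝ) + 1) * (legendreLam (p.1 + 1) * legendreLam p.2 * (((p.1 + 1).choose (m + 1) : ℕ) : ℝ))
                = legendreLam p.2 * (((m : ℝ) + 1) * (legendreLam (p.1 + 1) * (((p.1 + 1).choose (m + 1) : ℕ) : ℝ))) := by
                  ring
              _ = legendreLam p.2 * ((2 * (p.1 : ℝ) + 1) / 2 * legendreLam p.1 * (p.1.choose m : ℝ)) := by rw [e1]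
              _ = legendreLam p.1 * legendreLam p.2 * ((p.1 : ℝ) * (p.1.choose m : ℝ)) +
                    (1 / 2 : ℝ) * (legendreLam p.1 * legendreLam p.2 * (p.1.choose m : ℝ)) := by ring
              _ = _ := by rw [hc2]; ring
          have hm : ((m : ℝ) + 1) ≠ 0 := by positivity
          apply mul_left_cancel₀ hm
          rw [Finset.mul_sum]
          simp_rw [hterm]
          rw [Finset.sum_add_distrib, ← Finset.mul_sum, ← Finset.mul_sum, ihj, ih j]
          -- (m+1) λ_{m+1} C(j,m+1) + (m+½) λ_m C(j,m) = (m+1) λ_{m+1} C(j+1,m+1)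
          have hlm := legendreLam_succ_mul m
          have hpas : (((j + 1).choose (m + 1) : ℕ) : ℝ) = (j.choose m : ℝ) + (j.choose (m + 1) : ℝ) := by
            exact_mod_cast Nat.choose_succ_succ' j m
          rw [hpas]
          linear_combination (-(j.choose m : ℝ) / 2) * hlm

/-! ### The moments through Newton's forward differences -/

/-- The shifted power `x ↦ (2x - j)^{2k}` as a polynomial function. [folklore] -/
noncomputable def momFun (k j : ℕ) : ℝ → ℝ := fun x => (2 * x - (j : ℝ)) ^ (2 * k)

/-- Its power-sum form (binomial theorem): `Σ_{i ≤ 2k} C(2k,i) 2^i (-j)^{2k-i} x^i`. [folklore] -/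
theorem momFun_eq_sum (k j : ℕ) : momFun k j = fun x : ℝ =>
    ∑ i ∈ range (2 * k + 1), (((2 * k).choose i : ℝ) * 2 ^ i * (-(j : ℝ)) ^ (2 * k - i)) * x ^ i := by
  funext x
  rw [momFun, show 2 * x - (j : ℝ) = 2 * x + -(j : ℝ) by ring, add_pow]
  exact Finset.sum_congr rfl fun i _ => by rw [mul_pow]; ring

/-- The forward differences of `momFun k j` of order `> 2k` vanish. [folklore] -/
theorem fwdDiff_iter_momFun_eq_zero {k j n : ℕ} (hn : 2 * k < n) : (fwdDiff (1 : ℝ))^[n] (momFun k j) 0 = 0 := by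
  set cc : ℕ → ℝ := fun i => ((2 * k).choose i : ℝ) * 2 ^ i * (-(j : ℝ)) ^ (2 * k - i) with hcc
  have hpad : ∀ x : ℝ, momFun k j x = ∑ i ∈ range n, (if i ≤ 2 * k then cc i else 0) * x ^ i := by
    intro x
    rw [momFun_eq_sum]
    have h1 : ∑ i ∈ range (2 * k + 1), cc i * x ^ i =
        ∑ i ∈ range (2 * k + 1), (if i ≤ 2 * k then cc i else 0) * x ^ i :=
      Finset.sum_congr rfl fun i hi => by rw [if_pos (by simp only [mem_range] at hi; omega)]
    show ∑ i ∈ range (2 * k + 1), cc i * x ^ i = _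
    rw [h1]
    exact Finset.sum_subset (range_subset_range.2 (by omega)) fun i hi hi' => by
      rw [if_neg (by simp only [mem_range, not_lt] at hi hi'; omega), zero_mul]
  have hfun : momFun k j = fun x : ℝ => ∑ i ∈ range n, (if i ≤ 2 * k then cc i else 0) * x ^ i := funext hpad
  rw [hfun, fwdDiff_iter_sum_mul_pow_eq_zero]
  rfl

/-- `hMoment` as a λ-average of `momFun` at the naturals. [folklore] -/
theorem hMoment_eq_sum_momFun (k j : ℕ) :
    hMoment k j = ∑ p ∈ antidiagonal j, legendreLam p.1 * legendreLam p.2 * momFun k j (p.1 : ℝ) := by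
  unfold hMoment momFun
  refine Finset.sum_congr rfl fun p hp => ?_
  have : ((p.1 : ℝ) + p.2) = j := by exact_mod_cast mem_antidiagonal.mp hp
  rw [← this]
  ring

/-- Newton at a natural point: `f(p) = Σ_{m ≤ N} C(p,m) Δ^m f(0)` for any `N ≥ p`. [folklore] -/
theorem newton_nat (f : ℝ → ℝ) {p N : ℕ} (hpN : p ≤ N) :
    f (p : ℝ) = ∑ m ∈ range (N + 1), (p.choose m : ℝ) * (fwdDiff (1 : ℝ))^[m] f 0 := by
  have h := shift_eq_sum_fwdDiff_iter (1 : ℝ) f p 0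
  rw [zero_add, nsmul_eq_mul, mul_one] at h
  rw [h]
  refine (Finset.sum_congr rfl fun m _ => by rw [nsmul_eq_mul]).trans ?_
  refine Finset.sum_subset (range_subset_range.2 (by omega)) fun m hm hm' => ?_
  simp only [mem_range, not_lt] at hm hm'
  rw [Nat.choose_eq_zero_of_lt (by omega), Nat.cast_zero, zero_mul]

/-- **`hMoment` through forward differences**: `hMoment k j = Σ_{m ≤ 2k} λ_m C(j,m) Δ^m(momFun k j)(0)`.
[folklore] -/
theorem hMoment_eq_sum_fwdDiff (k j : ℕ) :
    hMoment k j = ∑ m ∈ range (2 * k + 1), legendreLam m * (j.choose m : ℝ) * (fwdDiff (1 : ℝ))^[m] (momFun k j) 0 := by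
  set N := j + 2 * k with hN
  rw [hMoment_eq_sum_momFun]
  -- Newton at each p ≤ j with the common bound N, then swap the sums
  have h1 : ∑ p ∈ antidiagonal j, legendreLam p.1 * legendreLam p.2 * momFun k j (p.1 : ℝ) =
      ∑ m ∈ range (N + 1), (fwdDiff (1 : ℝ))^[m] (momFun k j) 0 *
        ∑ p ∈ antidiagonal j, legendreLam p.1 * legendreLam p.2 * (p.1.choose m : ℝ) := by
    have hp : ∀ p ∈ antidiagonal j, legendreLam p.1 * legendreLam p.2 * momFun k j (p.1 : ℝ) =
        ∑ m ∈ range (N + 1), legendreLam p.1 * legendreLam p.2 * ((p.1.choose m : ℝ) * (fwdDiff (1 : ℝ))^[m] (momFun k j) 0) := by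
      intro p hpm
      have hpj : p.1 ≤ j := by have := mem_antidiagonal.mp hpm; omega
      rw [newton_nat (momFun k j) (show p.1 ≤ N by omega), Finset.mul_sum]
    rw [Finset.sum_congr rfl hp, Finset.sum_comm]
    refine Finset.sum_congr rfl fun m _ => ?_
    rw [Finset.mul_sum]
    exact Finset.sum_congr rfl fun p _ => by ring
  rw [h1]
  simp_rw [sum_antidiagonal_lam_mul_choose]
  -- cut the range at 2k: higher differences vanish
  symm
  refine (Finset.sum_subset (range_subset_range.2 (by omega)) fun m hm hm' => ?_).trans
    (Finset.sum_congr rfl fun m _ => by ring)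
  simp only [mem_range, not_lt] at hm hm'
  rw [fwdDiff_iter_momFun_eq_zero (by omega), mul_zero]

/-- **Closed form**: `hMoment k j = Σ_{m ≤ 2k} λ_m C(j,m) Σ_{i ≤ m} (-1)^{m-i} C(m,i) (2i - j)^{2k}` — a polynomial in `j`.
[folklore] -/
theorem hMoment_eq_sum (k j : ℕ) :
    hMoment k j = ∑ m ∈ range (2 * k + 1), legendreLam m * (j.choose m : ℝ) *
      ∑ i ∈ range (m + 1), (-1 : ℝ) ^ (m - i) * (m.choose i : ℝ) * (2 * (i : ℝ) - j) ^ (2 * k) := by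
  rw [hMoment_eq_sum_fwdDiff]
  refine Finset.sum_congr rfl fun m _ => ?_
  congr 1
  rw [fwdDiff_iter_eq_sum_shift]
  refine Finset.sum_congr rfl fun i _ => ?_
  rw [zero_add, nsmul_eq_mul, mul_one, zsmul_eq_mul, momFun]
  push_cast
  ring

/-- Fixture: the closed form reproduces `h₁ = j(j+1)/2` (cf. `hMoment_one`). [folklore] -/
theorem hMoment_eq_sum_one (j : ℕ) :
    (∑ m ∈ range (2 * 1 + 1), legendreLam m * (j.choose m : ℝ) *
      ∑ i ∈ range (m + 1), (-1 : ℝ) ^ (m - i) * (m.choose i : ℝ) * (2 * (i : ℝ) - j) ^ (2 * 1)) =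
      (j : ℝ) * ((j : ℝ) + 1) / 2 := by
  rw [← hMoment_eq_sum, hMoment_one]

/-! ### A computable coefficient list in `j` -/

/-- `C(j, m)` as a rational coefficient list in `j` is `chooseCoeffListQ m` (`TaylorQPolyIntervalList`); the inner
alternating sum as a list: `Σ_{i ≤ m} (-1)^{m-i} C(m,i) (2i - X)^{2k}`. [folklore] -/
def newtonInnerQ (k m : ℕ) : List ℚ :=
  (List.range (m + 1)).foldr
    (fun i acc => addQL (smulQL ((-1 : ℚ) ^ (m - i) * (m.choose i : ℚ))
      (powQL [2 * (i : ℚ), -1] (2 * k))) acc) []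
where
  /-- `l^n` by repeated `mulQL`. [folklore] -/
  powQL : List ℚ → ℕ → List ℚ
  | _, 0 => [1]
  | l, n + 1 => mulQL l (powQL l n)

/-- **`hMoment k` as a rational coefficient list in `j`**: `Σ_{m ≤ 2k} λ_m · C(X,m) · newtonInner`. [folklore] -/
def hMomentListQ (k : ℕ) : List ℚ :=
  (List.range (2 * k + 1)).foldr
    (fun m acc => addQL (smulQL (PointKernel.legendreLamQ m) (mulQL (chooseCoeffListQ m) (newtonInnerQ k m))) acc) []

/-- [folklore] -/
theorem evalR_powQL (l : List ℚ) (x : ℝ) : ∀ n : ℕ,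
    evalR ((newtonInnerQ.powQL l n).map ((↑) : ℚ → ℝ)) x = (evalR (l.map ((↑) : ℚ → ℝ)) x) ^ n
  | 0 => by simp [newtonInnerQ.powQL]
  | n + 1 => by rw [newtonInnerQ.powQL, map_cast_mulQL, evalR_mulR, evalR_powQL l x n, pow_succ']

/-- [folklore] -/
theorem evalR_foldr_addQL {ι : Type*} (F : ι → List ℚ) (x : ℝ) : ∀ l : List ι,
    evalR ((l.foldr (fun i acc => addQL (F i) acc) []).map ((↑) : ℚ → ℝ)) x =
      (l.map fun i => evalR ((F i).map ((↑) : ℚ → ℝ)) x).sum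
  | [] => by simp
  | i :: l => by
      rw [List.foldr_cons, map_cast_addQL, evalR_addR, evalR_foldr_addQL F x l, List.map_cons, List.sum_cons]

/-- [folklore] -/
theorem evalR_newtonInnerQ (k m : ℕ) (x : ℝ) :
    evalR ((newtonInnerQ k m).map ((↑) : ℚ → ℝ)) x =
      ∑ i ∈ range (m + 1), (-1 : ℝ) ^ (m - i) * (m.choose i : ℝ) * (2 * (i : ℝ) - x) ^ (2 * k) := by
  rw [newtonInnerQ, evalR_foldr_addQL, ← List.sum_toFinset _ List.nodup_range, List.toFinset_range]
  refine Finset.sum_congr rfl fun i _ => ?_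
  rw [map_cast_smulQL, evalR_smulR, evalR_powQL]
  have : evalR (([2 * (i : ℚ), -1] : List ℚ).map ((↑) : ℚ → ℝ)) x = 2 * (i : ℝ) - x := by
    simp [evalR]; ring
  rw [this]
  push_cast
  ring

/-- **`evalR (hMomentListQ k) j = hMoment k j`** at every natural `j`. [folklore] -/
theorem evalR_hMomentListQ (k j : ℕ) :
    evalR ((hMomentListQ k).map ((↑) : ℚ → ℝ)) (j : ℝ) = hMoment k j := by
  rw [hMomentListQ, evalR_foldr_addQL, ← List.sum_toFinset _ List.nodup_range, List.toFinset_range,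
    hMoment_eq_sum]
  refine Finset.sum_congr rfl fun m _ => ?_
  rw [map_cast_smulQL, evalR_smulR, map_cast_mulQL, evalR_mulR, map_cast_chooseCoeffListQ, evalR_chooseCoeffList,
    Ring.choose_natCast, evalR_newtonInnerQ, PointKernel.cast_legendreLamQ]
  ring

end Summit.CriticalPhenomena.Ising3D
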